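import Summits.QuantumAdvantage.QuantumAdvantage.Theorems.PeriodDialA
import HarnessLib

/-!
# PeriodDial (B) — §4a: the tabled period-4-universal-hard family P0 (`n ≡ 0 mod 8`, `n ≥ 56`, weight 7, radius 2)
(decomp-qadv lens-2 g30; the node memo is the module docstring of part A = `Theorems/PeriodDialA.lean`.)  All proofs complete.
-/

set_option linter.dupNamespace false
set_option linter.style.longLine false

noncomputable section
open scoped Classical

namespace Summit.QuantumAdvantage.QuantumAdvantage.Theorems.PeriodDial
open Finset
open Literature.Computability.QuantumComplexity Literature.Computability.QuantumComplexity.RingHLF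
open Literature.Computability.MetaComplexity Literature.Computability.MetaComplexity.Smolensky
open Summit.QuantumAdvantage.AdviceFreeQNC0 (OddZeros kernel_odd)
open Summit.QuantumAdvantage.AdviceFreeQNC0.Fib19 (IsOdd isOdd_iff_oddZeros kline kline_inKernel kline_hardCore)
open Summit.QuantumAdvantage.AdviceFreeQNC0.LightConeWindowHard
  (window window_apply dot2_eq_zero_of_pairing nxt_val prv_val xor3_eq_false_iff)
open Summit.QuantumAdvantage.QuantumAdvantage.Theorems.LightDial (wt wt_le_of_val_mem lightLosing LightFail)
open Summit.QuantumAdvantage.QuantumAdvantage.Theorems.ParityDial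
  (par IsParityLocal PLocalFail PGlobalFail OGlobalFail ParityUniversalHard closes₃ pLocalFail_two_seven window_eq_of_le window_centre
   parityUniversalHard_two_all not_rel_of_isParityLocal)
open Summit.QuantumAdvantage.QuantumAdvantage.Theses.ExactnessDial (NoPerfectTwo3)

variable {n : ℕ}

/-! ## §4 Two tabled PERIOD-4-UNIVERSAL-HARD families of weight 7 at radius 2 (generated by `num/gen_family4.py` from `num/famdata4.py`,
re-verified for `n = T, T+8, …, T+32` by `num/famcheck.py`; kernel-checked below): P0 for `n ≡ 0 (mod 8)`, `n ≥ 56`; P4 for `n ≡ 4 (mod 8)`,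
`n ≥ 60`.  Far zone `[T, n)`: all in the kernel support, all radius-2 windows zero, paired in blocks of eight by `t ↦ t ± 4` (class mod 4 and
window preserved) — the period-4 analogue of ParityDial's blocks of four. -/

/-! ### Family P0 (`n ≡ 0 mod 8`) -/

/-- family P0: the input with ones at `{3, 7, 11, 16, 31, 36, 52}` (weight 7), any length `n`. -/
def xP0 (n : ℕ) : Fin n → Bool := fun j => decide ((j : ℕ) = 3 ∨ (j : ℕ) = 7 ∨ (j : ℕ) = 11 ∨ (j : ℕ) = 16 ∨ (j : ℕ) = 31 ∨ (j : ℕ) = 36 ∨ (j : ℕ) = 52)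
/-- its kernel support: every position except `{4, 6, 12, 14, 16, 18, 20, 22, 24, 26, 28, 30, 37, 39, 41, 43, 45, 47, 49, 51}` (for `n ≡ 0 (mod 8)`, `n ≥ 56`). -/
abbrev VP0 (t : ℕ) : Prop := t ≠ 4 ∧ t ≠ 6 ∧ t ≠ 12 ∧ t ≠ 14 ∧ t ≠ 16 ∧ t ≠ 18 ∧ t ≠ 20 ∧ t ≠ 22 ∧ t ≠ 24 ∧ t ≠ 26 ∧ t ≠ 28 ∧ t ≠ 30 ∧ t ≠ 37 ∧ t ≠ 39 ∧ t ≠ 41 ∧ t ≠ 43 ∧ t ≠ 45 ∧ t ≠ 47 ∧ t ≠ 49 ∧ t ≠ 51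
/-- PeriodDial helper `vP0`: the kernel vector of `xP0` as a Boolean function. -/
def vP0 (n : ℕ) : Fin n → Bool := fun b => decide (VP0 b)
/-- the pairing of `supp vP0`: a table on `[0, 56)` (18 pairs of equal class mod 4 and equal radius-2 window) and the
blocks `t ↦ t ± 4` on the far stretch `[56, n)` (blocks of 8; all windows zero there). -/
def σP0val (t : ℕ) : ℕ :=
  if 56 ≤ t then (if (t - 56) % 8 < 4 then t + 4 else t - 4)
  else if t = 0 then 40
  else if t = 1 then 29
  else if t = 2 then 10
  else if t = 3 then 7
  else if t = 5 then 9
  else if t = 7 then 3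
  else if t = 8 then 32
  else if t = 9 then 5
  else if t = 10 then 2
  else if t = 11 then 31
  else if t = 13 then 33
  else if t = 15 then 35
  else if t = 17 then 53
  else if t = 19 then 23
  else if t = 21 then 25
  else if t = 23 then 19
  else if t = 25 then 21
  else if t = 27 then 55
  else if t = 29 then 1
  else if t = 31 then 11
  else if t = 32 then 8
  else if t = 33 then 13
  else if t = 34 then 50
  else if t = 35 then 15
  else if t = 36 then 52
  else if t = 38 then 54
  else if t = 40 then 0
  else if t = 42 then 46
  else if t = 44 then 48
  else if t = 46 then 42
  else if t = 48 then 44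
  else if t = 50 then 34
  else if t = 52 then 36
  else if t = 53 then 17
  else if t = 54 then 38
  else if t = 55 then 27
  else t
/-- PeriodDial helper `σP0`: the pairing as a map `Fin n → Fin n`. -/
def σP0 (n : ℕ) : Fin n → Fin n := fun b => ⟨min (σP0val b) (n - 1), by have := b.isLt; omega⟩

set_option maxHeartbeats 2000000 in
/-- PeriodDial helper `σP0_val`: the value of the pairing on the support, as a case list. -/
theorem σP0_val (hn : 56 ≤ n) (h8 : n % 8 = 0) (b : Fin n) (hb : vP0 n b = true) :
    ((b : ℕ) = 0 ∧ ((σP0 n b : Fin n) : ℕ) = 40) ∨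
    ((b : ℕ) = 1 ∧ ((σP0 n b : Fin n) : ℕ) = 29) ∨
    ((b : ℕ) = 2 ∧ ((σP0 n b : Fin n) : ℕ) = 10) ∨
    ((b : ℕ) = 3 ∧ ((σP0 n b : Fin n) : ℕ) = 7) ∨
    ((b : ℕ) = 5 ∧ ((σP0 n b : Fin n) : ℕ) = 9) ∨
    ((b : ℕ) = 7 ∧ ((σP0 n b : Fin n) : ℕ) = 3) ∨
    ((b : ℕ) = 8 ∧ ((σP0 n b : Fin n) : ℕ) = 32) ∨
    ((b : ℕ) = 9 ∧ ((σP0 n b : Fin n) : ℕ) = 5) ∨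
    ((b : ℕ) = 10 ∧ ((σP0 n b : Fin n) : ℕ) = 2) ∨
    ((b : ℕ) = 11 ∧ ((σP0 n b : Fin n) : ℕ) = 31) ∨
    ((b : ℕ) = 13 ∧ ((σP0 n b : Fin n) : ℕ) = 33) ∨
    ((b : ℕ) = 15 ∧ ((σP0 n b : Fin n) : ℕ) = 35) ∨
    ((b : ℕ) = 17 ∧ ((σP0 n b : Fin n) : ℕ) = 53) ∨
    ((b : ℕ) = 19 ∧ ((σP0 n b : Fin n) : ℕ) = 23) ∨
    ((b : ℕ) = 21 ∧ ((σP0 n b : Fin n) : ℕ) = 25) ∨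
    ((b : ℕ) = 23 ∧ ((σP0 n b : Fin n) : ℕ) = 19) ∨
    ((b : ℕ) = 25 ∧ ((σP0 n b : Fin n) : ℕ) = 21) ∨
    ((b : ℕ) = 27 ∧ ((σP0 n b : Fin n) : ℕ) = 55) ∨
    ((b : ℕ) = 29 ∧ ((σP0 n b : Fin n) : ℕ) = 1) ∨
    ((b : ℕ) = 31 ∧ ((σP0 n b : Fin n) : ℕ) = 11) ∨
    ((b : ℕ) = 32 ∧ ((σP0 n b : Fin n) : ℕ) = 8) ∨
    ((b : ℕ) = 33 ∧ ((σP0 n b : Fin n) : ℕ) = 13) ∨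
    ((b : ℕ) = 34 ∧ ((σP0 n b : Fin n) : ℕ) = 50) ∨
    ((b : ℕ) = 35 ∧ ((σP0 n b : Fin n) : ℕ) = 15) ∨
    ((b : ℕ) = 36 ∧ ((σP0 n b : Fin n) : ℕ) = 52) ∨
    ((b : ℕ) = 38 ∧ ((σP0 n b : Fin n) : ℕ) = 54) ∨
    ((b : ℕ) = 40 ∧ ((σP0 n b : Fin n) : ℕ) = 0) ∨
    ((b : ℕ) = 42 ∧ ((σP0 n b : Fin n) : ℕ) = 46) ∨
    ((b : ℕ) = 44 ∧ ((σP0 n b : Fin n) : ℕ) = 48) ∨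
    ((b : ℕ) = 46 ∧ ((σP0 n b : Fin n) : ℕ) = 42) ∨
    ((b : ℕ) = 48 ∧ ((σP0 n b : Fin n) : ℕ) = 44) ∨
    ((b : ℕ) = 50 ∧ ((σP0 n b : Fin n) : ℕ) = 34) ∨
    ((b : ℕ) = 52 ∧ ((σP0 n b : Fin n) : ℕ) = 36) ∨
    ((b : ℕ) = 53 ∧ ((σP0 n b : Fin n) : ℕ) = 17) ∨
    ((b : ℕ) = 54 ∧ ((σP0 n b : Fin n) : ℕ) = 38) ∨
    ((b : ℕ) = 55 ∧ ((σP0 n b : Fin n) : ℕ) = 27) ∨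
    (56 ≤ (b : ℕ) ∧ ((b : ℕ) - 56) % 8 < 4 ∧ ((σP0 n b : Fin n) : ℕ) = (b : ℕ) + 4) ∨
    (56 ≤ (b : ℕ) ∧ 4 ≤ ((b : ℕ) - 56) % 8 ∧ ((σP0 n b : Fin n) : ℕ) = (b : ℕ) - 4) := by
  have hlt := b.isLt
  simp only [vP0, decide_eq_true_eq] at hb
  simp only [σP0, Fin.val_mk]
  generalize hbt : (b : ℕ) = t at *
  by_cases hT : 56 ≤ t
  · have e : σP0val t = if (t - 56) % 8 < 4 then t + 4 else t - 4 := by unfold σP0val; rw [if_pos hT]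
    rw [e]
    split_ifs with hc
    · iterate 36 right
      left; exact ⟨hT, hc, by omega⟩
    · iterate 37 right
      exact ⟨hT, by omega, by omega⟩
  · interval_cases t <;> first | (exfalso; omega) | (simp [σP0val] <;> omega)

/-- PeriodDial helper `vP0_σP0`: the pairing preserves the support. -/
theorem vP0_σP0 (hn : 56 ≤ n) (h8 : n % 8 = 0) (b : Fin n) (hb : vP0 n b = true) : vP0 n (σP0 n b) = true := by
  have h := σP0_val hn h8 b hb
  have hb' : VP0 b := by simpa only [vP0, decide_eq_true_eq] using hb
  simp only [vP0, decide_eq_true_eq]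
  rcases h with h | h | h | h | h | h | h | h | h | h | h | h | h | h | h | h | h | h | h | h | h | h | h | h | h | h | h | h | h | h | h | h | h | h | h | h | h | h <;> omega

/-- PeriodDial helper `cls_σP0`: the pairing preserves the class mod 4. -/
theorem cls_σP0 (hn : 56 ≤ n) (h8 : n % 8 = 0) (b : Fin n) (hb : vP0 n b = true) : cls 4 (σP0 n b) = cls 4 b := by
  have h := σP0_val hn h8 b hb
  simp only [cls]
  rcases h with h | h | h | h | h | h | h | h | h | h | h | h | h | h | h | h | h | h | h | h | h | h | h | h | h | h | h | h | h | h | h | h | h | h | h | h | h | h <;> omega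

/-- PeriodDial helper `σP0_ne`: the pairing is fixed-point free on the support. -/
theorem σP0_ne (hn : 56 ≤ n) (h8 : n % 8 = 0) (b : Fin n) (hb : vP0 n b = true) : σP0 n b ≠ b := by
  have h := σP0_val hn h8 b hb
  intro he
  have h' := congrArg Fin.val he
  rcases h with h | h | h | h | h | h | h | h | h | h | h | h | h | h | h | h | h | h | h | h | h | h | h | h | h | h | h | h | h | h | h | h | h | h | h | h | h | h <;> omega

/-- PeriodDial helper `σP0_σP0`: the pairing is an involution on the support. -/
theorem σP0_σP0 (hn : 56 ≤ n) (h8 : n % 8 = 0) (b : Fin n) (hb : vP0 n b = true) : σP0 n (σP0 n b) = b := by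
  have h1 := σP0_val hn h8 b hb
  have h2 := σP0_val hn h8 (σP0 n b) (vP0_σP0 hn h8 b hb)
  apply Fin.ext
  rcases h1 with h | h | h | h | h | h | h | h | h | h | h | h | h | h | h | h | h | h | h | h | h | h | h | h | h | h | h | h | h | h | h | h | h | h | h | h | h | h <;> omega

set_option maxHeartbeats 4000000 in
/-- PeriodDial helper `window_σP0`: the pairing preserves the radius-2 window of `xP0`. -/
theorem window_σP0 (hn : 56 ≤ n) (h8 : n % 8 = 0) (b : Fin n) (hb : vP0 n b = true) :
    window 2 (xP0 n) (σP0 n b) = window 2 (xP0 n) b := by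
  have h := σP0_val hn h8 b hb
  have hlt := b.isLt
  funext d
  have hd := d.isLt
  rw [window_apply 2 (by omega), window_apply 2 (by omega)]
  simp only [xP0, decide_eq_decide]
  generalize hs : ((σP0 n b : Fin n) : ℕ) = s at *
  generalize hdd : (d : ℕ) = dd at *
  generalize ht : (b : ℕ) = t at *
  interval_cases dd <;>
  · rcases h with ⟨rfl, rfl⟩ | ⟨rfl, rfl⟩ | ⟨rfl, rfl⟩ | ⟨rfl, rfl⟩ | ⟨rfl, rfl⟩ | ⟨rfl, rfl⟩ | ⟨rfl, rfl⟩ | ⟨rfl, rfl⟩ | ⟨rfl, rfl⟩ | ⟨rfl, rfl⟩ | ⟨rfl, rfl⟩ | ⟨rfl, rfl⟩ | ⟨rfl, rfl⟩ | ⟨rfl, rfl⟩ | ⟨rfl, rfl⟩ | ⟨rfl, rfl⟩ | ⟨rfl, rfl⟩ | ⟨rfl, rfl⟩ | ⟨rfl, rfl⟩ | ⟨rfl, rfl⟩ | ⟨rfl, rfl⟩ | ⟨rfl, rfl⟩ | ⟨rfl, rfl⟩ | ⟨rfl, rfl⟩ | ⟨rfl, rfl⟩ | ⟨rfl, rfl⟩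 | ⟨rfl, rfl⟩ | ⟨rfl, rfl⟩ | ⟨rfl, rfl⟩ | ⟨rfl, rfl⟩ | ⟨rfl, rfl⟩ | ⟨rfl, rfl⟩ | ⟨rfl, rfl⟩ | ⟨rfl, rfl⟩ | ⟨rfl, rfl⟩ | ⟨rfl, rfl⟩ | ⟨hT, hm, rfl⟩ | ⟨hT, hm, rfl⟩
    all_goals first
      | ((try simp (disch := omega) only [if_pos, if_neg, true_or, or_true]) <;> omega)
      | (split_ifs <;> ((try simp) <;> omega))

/-- PeriodDial helper `inKernel_vP0`: `vP0` is a kernel vector of `xP0` (`n ≥ 56`). -/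
theorem inKernel_vP0 (hn : 56 ≤ n) : InKernel (xP0 n) (vP0 n) := by
  intro b
  rw [xor3_eq_false_iff]
  have hb := b.isLt
  simp only [vP0, xP0, Bool.and_eq_true, decide_eq_true_eq, ne_eq, decide_eq_decide, prv_val, nxt_val]
  split_ifs <;> omega

/-- PeriodDial helper `edgesIn_vP0`: the support has `n − 40` inner edges. -/
theorem edgesIn_vP0 (hn : 56 ≤ n) : edgesIn (vP0 n) = n - 40 := by
  unfold edgesIn
  have h : (univ.filter fun b : Fin n => vP0 n b = true ∧ vP0 n (nxt b) = true)
      = univ \ ({3, 4, 5, 6, 11, 12, 13, 14, 15, 16, 17, 18, 19, 20, 21, 22, 23, 24, 25, 26, 27, 28, 29, 30, 36, 37, 38, 39, 40, 41, 42, 43, 44, 45, 46, 47, 48, 49, 50, 51} : Finset ℕ).attachFin (by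
          intro t ht; simp only [mem_insert, mem_singleton] at ht; omega) := by
    ext b
    have hb := b.isLt
    simp only [mem_filter, mem_univ, true_and, mem_sdiff, mem_attachFin, vP0, decide_eq_true_eq, nxt_val, mem_insert,
      mem_singleton]
    split_ifs <;> omega
  have hc : ({3, 4, 5, 6, 11, 12, 13, 14, 15, 16, 17, 18, 19, 20, 21, 22, 23, 24, 25, 26, 27, 28, 29, 30, 36, 37, 38, 39, 40, 41, 42, 43, 44, 45, 46, 47, 48, 49, 50, 51} : Finset ℕ).card = 40 := by rfl
  rw [h, card_sdiff_of_subset (subset_univ _), card_attachFin, card_univ, Fintype.card_fin, hc]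

/-- PeriodDial helper `wtAnd_xP0`: `6` ones of `xP0` lie in the support. -/
theorem wtAnd_xP0 (hn : 56 ≤ n) : wtAnd (xP0 n) (vP0 n) = 6 := by
  unfold wtAnd
  have h : (univ.filter fun b : Fin n => xP0 n b = true ∧ vP0 n b = true)
      = ({3, 7, 11, 31, 36, 52} : Finset ℕ).attachFin (by intro t ht; simp only [mem_insert, mem_singleton] at ht; omega) := by
    ext b
    have hb := b.isLt
    simp only [mem_filter, mem_univ, true_and, mem_attachFin, vP0, xP0, decide_eq_true_eq, mem_insert, mem_singleton]
    omega
  have hc : ({3, 7, 11, 31, 36, 52} : Finset ℕ).card = 6 := by rfl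
  rw [h, card_attachFin, hc]

/-- PeriodDial helper `signBit_xP0`: the sign bit of the certificate is `1` (`n ≡ 0 (mod 8)`, `n ≥ 56`). -/
theorem signBit_xP0 (hn : 56 ≤ n) (h8 : n % 8 = 0) : signBit (xP0 n) (vP0 n) = 1 := by
  unfold signBit; rw [edgesIn_vP0 hn, wtAnd_xP0 hn]; omega

/-- PeriodDial helper `card_zeros_xP0`: `xP0` has `n − 7` zeros. -/
theorem card_zeros_xP0 (hn : 56 ≤ n) : (univ.filter fun b : Fin n => xP0 n b = false).card = n - 7 := by
  have h : (univ.filter fun b : Fin n => xP0 n b = false)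
      = univ \ ({3, 7, 11, 16, 31, 36, 52} : Finset ℕ).attachFin (by
          intro t ht; simp only [mem_insert, mem_singleton] at ht; omega) := by
    ext b
    simp only [mem_filter, mem_univ, true_and, mem_sdiff, mem_attachFin, xP0, decide_eq_false_iff_not, mem_insert,
      mem_singleton]
  have hc : ({3, 7, 11, 16, 31, 36, 52} : Finset ℕ).card = 7 := by rfl
  rw [h, card_sdiff_of_subset (subset_univ _), card_attachFin, card_univ, Fintype.card_fin, hc]

/-- PeriodDial helper `oddZeros_xP0`: `xP0` lies in the odd class when `n` is even (`n ≥ 56`). -/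
theorem oddZeros_xP0 (hn : 56 ≤ n) (h8 : n % 8 = 0) : OddZeros (xP0 n) := by
  unfold OddZeros; rw [card_zeros_xP0 hn]; omega

/-- PeriodDial helper `wt_xP0`: `xP0` is LIGHT — weight `≤ 7`. -/
theorem wt_xP0 (n : ℕ) : wt (xP0 n) ≤ 7 :=
  wt_le_of_val_mem [3, 7, 11, 16, 31, 36, 52] fun j hj => by
    simp only [xP0, decide_eq_true_eq] at hj
    simp only [List.mem_cons, List.not_mem_nil, or_false]
    omega

/-- ★ FAMILY P0 IS PERIOD-4-UNIVERSAL-HARD at radius 2: for every `n ≡ 0 (mod 8)`, `n ≥ 56`, the weight-7 input `xP0 n` defeats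
EVERY 4-periodic rule table of radius 2 (hence every such rule with any input-global advice, `periodicUniversalHard_any_advice`). -/
theorem xP0_periodicUniversalHard (hn : 56 ≤ n) (h8 : n % 8 = 0) : PeriodicUniversalHard 4 2 (xP0 n) :=
  periodicUniversalHard_of_pairing 4 2 (xP0 n) (vP0 n) (σP0 n) (oddZeros_xP0 hn h8) (inKernel_vP0 hn)
    (signBit_xP0 hn h8) (vP0_σP0 hn h8) (window_σP0 hn h8) (cls_σP0 hn h8) (σP0_ne hn h8) (σP0_σP0 hn h8)


end Summit.QuantumAdvantage.QuantumAdvantage.Theorems.PeriodDial
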